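import Mathlib
import Literature.Analysis.ODE.ComponentwisePerturbation
import Summits.NavierStokesRegularity.NavierStokesRegularity.Theorems.TaoLadderRungTwoBreakOneShiftWindowKrawczykSlope
import HarnessLib

/-!
# The one-shift window system, XV: the DEVIATION of a rough-tail pair difference from the centre pair difference
# is LINEAR in the initial difference — a Kapela–Zgliczyński estimate in the form the step slope needs
# (cell harvest/h2-tao-ladder, seat p2; rung1/KERNEL-CHEAP-REPLAY-SPEC.md §2 (e) (Xb) / §3 S2,
# rung1/RUNG1-P2G12-REPORT.md §54; support for K1(1) = `NoSurvivingDSSOne`, stmt-NavierStokesRegularity-20205)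

MODEL lattice ODEs only (Tao 2016 §4 normal form on Tao's shift set `S`); nothing here is a statement about
the Navier–Stokes equations; no item is closed; nothing numerical is proved. Generic in the index type `ι`.

Part XIV (`exists_stepSlope`) turns a centre slope `w_c = M d` plus a deviation bound
`|w − w_c|_i ≤ Σ_l Xb_il |d_l|` into the pair slope of one step. This file proves the deviation bound from the
differential structure of the two pair differences over the step, WITHOUT fundamental matrices, uniqueness or any
differentiability of the rough-tail flow:

  `w' = A(t) w`, `w_c' = A_c(t) w_c` on `[0, h]`, `w(0) = w_c(0) = d`,

where `A(t)`, `A_c(t)` are ANY real matrices (slope matrices of the two fields between the respective pair of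
trajectories at time `t` — part XIV `exists_slopeMatrix_of_fderiv` at each `t`; no regularity in `t`) with
`A_c(t)_ii ≤ dg_i`, `|A_c(t)_ij| ≤ R_ij` (`j ≠ i`), `|A(t) − A_c(t)| ≤ AΔ` entrywise, and an a priori bound
`|w(t)_j| ≤ Σ_l Wb_jl |d_l|`. Then `y = w − w_c` satisfies `y' = A_c y + (A − A_c) w`, and the componentwise
perturbation lemma (`Literature.Analysis.ODE.abs_le_of_componentwisePerturbation_uniform`, Kapela–Zgliczyński
2009 §4) with the data `Z_ε = Ẑ|d| + ε ζ` gives, after `ε → 0`: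

* `abs_pairDeviation_le` — **`|w(t) − w_c(t)|_i ≤ Σ_l Ẑ_il |d_l|` on `[0, h]`** provided the two finite checks
  `((R Ẑ + AΔ Wb) ∘ E)_{il} ≤ Ẑ_il` (matrix fixed point) and `((R ζ) ∘ E)_i ≤ ζ_i` for some vector `ζ > 0`
  (contraction direction), `E_i ≥ ∫₀ʰ e^{dg_i r} dr` — the engine's `Xb = h |VU′| A_Δ |VU′|` is such a `Ẑ` up to
  the exponential weights.
-/

noncomputable section

-- the sub-problem namespace repeats the summit name by design (D-0017)
set_option linter.dupNamespace false

namespace Summit.NavierStokesRegularity.NavierStokesRegularity.Theorems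

namespace DSSOneShift

open Set Metric Filter Topology Literature.Analysis.ODE

variable {ι : Type*} [Fintype ι] [DecidableEq ι]

/-- The `i`-th component of `A · w − A_c · w_c` minus `A_c ii (w − w_c)_i` splits into the field-difference part
and the off-diagonal part. [folklore] -/
theorem mulVec_sub_mulVec_split (A Ac : Matrix ι ι ℝ) (w wc : ι → ℝ) (i : ι) :
    (A.mulVec w) i - (Ac.mulVec wc) i - Ac i i * (w i - wc i) =
      (∑ j, (A i j - Ac i j) * w j) + ∑ j ∈ Finset.univ.erase i, Ac i j * (w j - wc j) := by
  classical
  rw [Finset.sum_erase_eq_sub (Finset.mem_univ i)]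
  simp only [Matrix.mulVec, dotProduct, ← Finset.sum_sub_distrib]
  have e : ∑ j, (A i j * w j - Ac i j * wc j) = ∑ j, ((A i j - Ac i j) * w j + Ac i j * (w j - wc j)) :=
    Finset.sum_congr rfl fun j _ => by ring
  rw [e, Finset.sum_add_distrib]
  ring

omit [DecidableEq ι] in
/-- A nonnegative matrix applied to absolute values is nonnegative. [folklore] -/
theorem sum_mul_abs_nonneg {X : ι → ι → ℝ} (hX : ∀ i j, 0 ≤ X i j) (d : ι → ℝ) (i : ι) :
    0 ≤ ∑ l, X i l * |d l| :=
  Finset.sum_nonneg fun l _ => mul_nonneg (hX i l) (abs_nonneg _)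

/-- **THE PAIR DEVIATION IS LINEAR IN THE INITIAL DIFFERENCE** (Kapela–Zgliczyński form). Two pair differences
`w` (rough-tail system) and `w_c` (centre system) on `[0, h]` with the same initial value `d`, derivatives within
`[0, h]` given by real matrices `A(t)`, `A_c(t)` applied to themselves (any matrices, no regularity in `t`) with
`A_c(t)_ii ≤ dg_i`, `|A_c(t)_ij| ≤ R_ij` off the diagonal, `|A(t) − A_c(t)| ≤ AΔ`, an a priori bound
`|w(t)| ≤ Wb |d|`, weights `E_i ≥ ∫₀ʰ e^{dg_i r} dr`, and the two finite checks: matrix fixed point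
`(Σ_j R_ij Ẑ_jl + Σ_j AΔ_ij Wb_jl) E_i ≤ Ẑ_il` and contraction direction `(Σ_j R_ij ζ_j) E_i ≤ ζ_i`, `ζ > 0`.
Then `|w(t) − w_c(t)|_i ≤ Σ_l Ẑ_il |d_l|` for all `t ∈ [0, h]` — the hypothesis `hdev` of part XIV
`exists_stepSlope` with `Xb = Ẑ`. [cite: KapelaZgliczynski2009, §4 Lemma 8 / Thm. 9; cell vocabulary, harvest/h2-tao-ladder rung1/KERNEL-CHEAP-REPLAY-SPEC.md §2 (e) (Xb)] -/
theorem abs_pairDeviation_le {w wc w' wc' : ℝ → ι → ℝ} {h : ℝ} (hh : 0 ≤ h)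
    (hw : ∀ t ∈ Icc 0 h, HasDerivWithinAt w (w' t) (Icc 0 h) t)
    (hwc : ∀ t ∈ Icc 0 h, HasDerivWithinAt wc (wc' t) (Icc 0 h) t)
    {d : ι → ℝ} (hw0 : w 0 = d) (hwc0 : wc 0 = d)
    {dg : ι → ℝ} {R AΔ Wb Zh : ι → ι → ℝ} {E ζ : ι → ℝ}
    (hR : ∀ i j, 0 ≤ R i j) (hAΔ : ∀ i j, 0 ≤ AΔ i j) (hWb : ∀ i j, 0 ≤ Wb i j) (hZh : ∀ i j, 0 ≤ Zh i j)
    (hstruct : ∀ t ∈ Ico 0 h, ∃ A Ac : Matrix ι ι ℝ,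
      w' t = A.mulVec (w t) ∧ wc' t = Ac.mulVec (wc t) ∧ (∀ i, Ac i i ≤ dg i) ∧
      (∀ i j, i ≠ j → |Ac i j| ≤ R i j) ∧ (∀ i j, |A i j - Ac i j| ≤ AΔ i j))
    (hapriori : ∀ t ∈ Ico 0 h, ∀ j, |w t j| ≤ ∑ l, Wb j l * |d l|)
    (hE : ∀ i, gronwallBound 0 (dg i) 1 h ≤ E i)
    (hfix : ∀ i l, ((∑ j, R i j * Zh j l) + ∑ j, AΔ i j * Wb j l) * E i ≤ Zh i l)
    (hζ0 : ∀ i, 0 < ζ i) (hζ : ∀ i, (∑ j, R i j * ζ j) * E i ≤ ζ i) :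
    ∀ t ∈ Icc 0 h, ∀ i, |w t i - wc t i| ≤ ∑ l, Zh i l * |d l| := by
  classical
  intro t ht i
  -- the deviation and its derivative
  set y : ℝ → ι → ℝ := fun s => w s - wc s with hy
  set y' : ℝ → ι → ℝ := fun s => w' s - wc' s with hy'
  have hyc : ContinuousOn y (Icc 0 h) := fun s hs =>
    ((hw s hs).continuousWithinAt).sub ((hwc s hs).continuousWithinAt)
  have hyd : ∀ s ∈ Ico 0 h, HasDerivWithinAt y (y' s) (Ici s) s := by
    intro s hs
    have hmem : Icc 0 h ∈ 𝓝[≥] s := mem_of_superset (Icc_mem_nhdsGE hs.2) (Icc_subset_Icc_left hs.1)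
    exact ((hw s (Ico_subset_Icc_self hs)).sub (hwc s (Ico_subset_Icc_self hs))).mono_of_mem_nhdsWithin hmem
  have hy0 : y 0 = 0 := by simp [hy, hw0, hwc0]
  -- the forcing `g = AΔ · Wb · |d|`
  set g : ι → ℝ := fun i => ∑ j, AΔ i j * ∑ l, Wb j l * |d l| with hg
  have hg0 : ∀ i, 0 ≤ g i := fun i => Finset.sum_nonneg fun j _ => mul_nonneg (hAΔ i j) (sum_mul_abs_nonneg hWb d j)
  -- the componentwise differential inequality
  have hfield : ∀ s ∈ Ico 0 h, ∀ i, ∃ a ≤ dg i, |y' s i - a * y s i| ≤ (∑ j, R i j * |y s j|) + g i := by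
    intro s hs i
    obtain ⟨A, Ac, hA, hAc, hdiag, hoff, hdiff⟩ := hstruct s hs
    refine ⟨Ac i i, hdiag i, ?_⟩
    have e : y' s i - Ac i i * y s i =
        (∑ j, (A i j - Ac i j) * w s j) + ∑ j ∈ Finset.univ.erase i, Ac i j * (w s j - wc s j) := by
      simp only [hy, hy', Pi.sub_apply, hA, hAc]
      exact mulVec_sub_mulVec_split A Ac (w s) (wc s) i
    rw [e, add_comm]
    refine (abs_add_le _ _).trans (add_le_add ?_ ?_)
    · -- off-diagonal part
      calc |∑ j ∈ Finset.univ.erase i, Ac i j * (w s j - wc s j)|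
          ≤ ∑ j ∈ Finset.univ.erase i, |Ac i j * (w s j - wc s j)| := Finset.abs_sum_le_sum_abs _ _
        _ ≤ ∑ j ∈ Finset.univ.erase i, R i j * |y s j| := Finset.sum_le_sum fun j hj => by
            rw [abs_mul]
            exact mul_le_mul_of_nonneg_right (hoff i j (Finset.ne_of_mem_erase hj).symm) (abs_nonneg _)
        _ ≤ ∑ j, R i j * |y s j| :=
            Finset.sum_le_sum_of_subset_of_nonneg (Finset.erase_subset _ _)
              fun j _ _ => mul_nonneg (hR i j) (abs_nonneg _)
    · -- field-difference part
      calc |∑ j, (A i j - Ac i j) * w s j| ≤ ∑ j, |(A i j - Ac i j) * w s j| := Finset.abs_sum_le_sum_abs _ _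
        _ ≤ ∑ j, AΔ i j * ∑ l, Wb j l * |d l| := Finset.sum_le_sum fun j _ => by
            rw [abs_mul]
            exact mul_le_mul (hdiff i j) (hapriori s hs j) (abs_nonneg _) (hAΔ i j)
  -- swapping the double sums
  have hswap : ∀ (i' : ι) (P Q : ι → ι → ℝ),
      ∑ j, P i' j * ∑ l, Q j l * |d l| = ∑ l, (∑ j, P i' j * Q j l) * |d l| := by
    intro i' P Q
    simp_rw [Finset.mul_sum, Finset.sum_mul]
    rw [Finset.sum_comm]
    exact Finset.sum_congr rfl fun l _ => Finset.sum_congr rfl fun j _ => by ring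
  -- `ε`-inflated Kapela–Zgliczyński data
  have hbound : ∀ ε : ℝ, 0 < ε → |y t i| ≤ (∑ l, Zh i l * |d l|) + ε * ζ i := by
    intro ε hε
    set Z : ι → ℝ := fun i => (∑ l, Zh i l * |d l|) + ε * ζ i with hZdef
    have hZ0 : ∀ i, 0 < Z i := fun i =>
      add_pos_of_nonneg_of_pos (sum_mul_abs_nonneg hZh d i) (mul_pos hε (hζ0 i))
    have hZ : ∀ i', ((∑ j, R i' j * Z j) + g i') * E i' ≤ Z i' := by
      intro i'
      have a1 : ∑ j, R i' j * Z j = (∑ j, R i' j * ∑ l, Zh j l * |d l|) + ε * ∑ j, R i' j * ζ j := by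
        rw [Finset.mul_sum, ← Finset.sum_add_distrib]
        exact Finset.sum_congr rfl fun j _ => by simp only [hZdef]; ring
      have s1 : (∑ j, R i' j * Z j) + g i' =
          (∑ l, ((∑ j, R i' j * Zh j l) + ∑ j, AΔ i' j * Wb j l) * |d l|) + ε * ∑ j, R i' j * ζ j := by
        rw [a1, hswap i' R Zh, show g i' = ∑ l, (∑ j, AΔ i' j * Wb j l) * |d l| from hswap i' AΔ Wb,
          add_right_comm, ← Finset.sum_add_distrib]
        congr 1
        exact Finset.sum_congr rfl fun l _ => by ring
      rw [s1, add_mul, Finset.sum_mul]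
      refine add_le_add (Finset.sum_le_sum fun l _ => ?_) ?_
      · calc ((∑ j, R i' j * Zh j l) + ∑ j, AΔ i' j * Wb j l) * |d l| * E i'
            = (((∑ j, R i' j * Zh j l) + ∑ j, AΔ i' j * Wb j l) * E i') * |d l| := by ring
          _ ≤ Zh i' l * |d l| := mul_le_mul_of_nonneg_right (hfix i' l) (abs_nonneg _)
      · calc ε * (∑ j, R i' j * ζ j) * E i' = ε * ((∑ j, R i' j * ζ j) * E i') := by ring
          _ ≤ ε * ζ i' := mul_le_mul_of_nonneg_left (hζ i') hε.le
    have hKZ := abs_le_of_componentwisePerturbation_uniform hh hyc hyd hy0 hR hg0 hZ0 hfield hE hZ ht i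
    exact hKZ.1.trans hKZ.2
  -- `ε → 0`
  have hζi := hζ0 i
  refine le_of_forall_pos_le_add fun ε hε => ?_
  have := hbound (ε / ζ i) (div_pos hε hζi)
  rwa [div_mul_cancel₀ _ hζi.ne'] at this

/-- **A PRIORI GROWTH OF A PAIR DIFFERENCE, linear in the initial difference** (the `Wb` of
`abs_pairDeviation_le`; Kapela–Zgliczyński form). If `w' = A(t) w` on `[0, h]` with `w(0) = d`, for real matrices
`A(t)` (any, per `t`) with `A(t)_ii ≤ dg_i`, `|A(t)_ij| ≤ R_ij` off the diagonal and `|A(t)_ij| ≤ Ab_ij`, weights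
`E_i ≥ ∫₀ʰ e^{dg_i r} dr`, the matrix fixed point `(Σ_j R_ij Ẑ_jl + Ab_il) E_i ≤ Ẑ_il` and a contraction direction
`ζ > 0`, then `|w(t) − d|_i ≤ Σ_l Ẑ_il |d_l|` on `[0, h]` (so `|w(t)|_i ≤ |d_i| + Σ_l Ẑ_il |d_l|`). Proof: `y = w − d`
has `y' = A y + A d`. [cite: KapelaZgliczynski2009, §4 Lemma 8 / Thm. 9; cell vocabulary, harvest/h2-tao-ladder rung1/KERNEL-CHEAP-REPLAY-SPEC.md §2 (d) (VU′)] -/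
theorem abs_pairGrowth_le {w w' : ℝ → ι → ℝ} {h : ℝ} (hh : 0 ≤ h)
    (hw : ∀ t ∈ Icc 0 h, HasDerivWithinAt w (w' t) (Icc 0 h) t) {d : ι → ℝ} (hw0 : w 0 = d)
    {dg : ι → ℝ} {R Ab Zh : ι → ι → ℝ} {E ζ : ι → ℝ}
    (hR : ∀ i j, 0 ≤ R i j) (hAb : ∀ i j, 0 ≤ Ab i j) (hZh : ∀ i j, 0 ≤ Zh i j)
    (hstruct : ∀ t ∈ Ico 0 h, ∃ A : Matrix ι ι ℝ, w' t = A.mulVec (w t) ∧ (∀ i, A i i ≤ dg i) ∧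
      (∀ i j, i ≠ j → |A i j| ≤ R i j) ∧ (∀ i j, |A i j| ≤ Ab i j))
    (hE : ∀ i, gronwallBound 0 (dg i) 1 h ≤ E i)
    (hfix : ∀ i l, ((∑ j, R i j * Zh j l) + Ab i l) * E i ≤ Zh i l)
    (hζ0 : ∀ i, 0 < ζ i) (hζ : ∀ i, (∑ j, R i j * ζ j) * E i ≤ ζ i) :
    ∀ t ∈ Icc 0 h, ∀ i, |w t i - d i| ≤ ∑ l, Zh i l * |d l| := by
  classical
  intro t ht i
  set y : ℝ → ι → ℝ := fun s => w s - d with hy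
  have hyc : ContinuousOn y (Icc 0 h) := fun s hs => ((hw s hs).continuousWithinAt).sub continuousWithinAt_const
  have hyd : ∀ s ∈ Ico 0 h, HasDerivWithinAt y (w' s) (Ici s) s := by
    intro s hs
    have hmem : Icc 0 h ∈ 𝓝[≥] s := mem_of_superset (Icc_mem_nhdsGE hs.2) (Icc_subset_Icc_left hs.1)
    have h1 := ((hw s (Ico_subset_Icc_self hs)).sub_const d).mono_of_mem_nhdsWithin hmem
    exact h1
  have hy0 : y 0 = 0 := by simp [hy, hw0]
  set g : ι → ℝ := fun i => ∑ l, Ab i l * |d l| with hg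
  have hg0 : ∀ i, 0 ≤ g i := fun i => sum_mul_abs_nonneg hAb d i
  have hfield : ∀ s ∈ Ico 0 h, ∀ i, ∃ a ≤ dg i, |w' s i - a * y s i| ≤ (∑ j, R i j * |y s j|) + g i := by
    intro s hs i
    obtain ⟨A, hA, hdiag, hoff, hAbs⟩ := hstruct s hs
    refine ⟨A i i, hdiag i, ?_⟩
    -- `w' = A w = A y + A d`
    have e : w' s i - A i i * y s i =
        (∑ j, (A i j - (0 : Matrix ι ι ℝ) i j) * (fun _ => d) s j) +
          ∑ j ∈ Finset.univ.erase i, A i j * (w s j - (fun _ : ℝ => d) s j) := by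
      -- `A w = A y + A d`
      have e1 : w' s i = (A.mulVec (y s)) i + (A.mulVec d) i := by
        rw [hA, ← Pi.add_apply, ← Matrix.mulVec_add]
        congr 1
        ext j; simp [hy]
      rw [e1]
      simp only [Matrix.mulVec, dotProduct, Matrix.zero_apply, sub_zero, hy, Pi.sub_apply]
      rw [Finset.sum_erase_eq_sub (Finset.mem_univ i)]
      ring
    rw [e, add_comm]
    refine (abs_add_le _ _).trans (add_le_add ?_ ?_)
    · calc |∑ j ∈ Finset.univ.erase i, A i j * (w s j - (fun _ : ℝ => d) s j)|
          ≤ ∑ j ∈ Finset.univ.erase i, |A i j * (w s j - (fun _ : ℝ => d) s j)| :=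
            Finset.abs_sum_le_sum_abs _ _
        _ ≤ ∑ j ∈ Finset.univ.erase i, R i j * |y s j| := Finset.sum_le_sum fun j hj => by
            rw [abs_mul]
            exact mul_le_mul_of_nonneg_right (hoff i j (Finset.ne_of_mem_erase hj).symm) (abs_nonneg _)
        _ ≤ ∑ j, R i j * |y s j| :=
            Finset.sum_le_sum_of_subset_of_nonneg (Finset.erase_subset _ _)
              fun j _ _ => mul_nonneg (hR i j) (abs_nonneg _)
    · calc |∑ j, (A i j - (0 : Matrix ι ι ℝ) i j) * (fun _ : ℝ => d) s j|
          ≤ ∑ j, |(A i j - (0 : Matrix ι ι ℝ) i j) * (fun _ : ℝ => d) s j| := Finset.abs_sum_le_sum_abs _ _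
        _ ≤ ∑ l, Ab i l * |d l| := Finset.sum_le_sum fun j _ => by
            rw [abs_mul]
            exact mul_le_mul_of_nonneg_right (by simpa using hAbs i j) (abs_nonneg _)
  have hbound : ∀ ε : ℝ, 0 < ε → |y t i| ≤ (∑ l, Zh i l * |d l|) + ε * ζ i := by
    intro ε hε
    set Z : ι → ℝ := fun i => (∑ l, Zh i l * |d l|) + ε * ζ i with hZdef
    have hZ0 : ∀ i, 0 < Z i := fun i =>
      add_pos_of_nonneg_of_pos (sum_mul_abs_nonneg hZh d i) (mul_pos hε (hζ0 i))
    have hZ : ∀ i', ((∑ j, R i' j * Z j) + g i') * E i' ≤ Z i' := by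
      intro i'
      have a1 : ∑ j, R i' j * Z j = (∑ j, R i' j * ∑ l, Zh j l * |d l|) + ε * ∑ j, R i' j * ζ j := by
        rw [Finset.mul_sum, ← Finset.sum_add_distrib]
        exact Finset.sum_congr rfl fun j _ => by simp only [hZdef]; ring
      have hswap : ∑ j, R i' j * ∑ l, Zh j l * |d l| = ∑ l, (∑ j, R i' j * Zh j l) * |d l| := by
        simp_rw [Finset.mul_sum, Finset.sum_mul]
        rw [Finset.sum_comm]
        exact Finset.sum_congr rfl fun l _ => Finset.sum_congr rfl fun j _ => by ring
      have s1 : (∑ j, R i' j * Z j) + g i' =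
          (∑ l, ((∑ j, R i' j * Zh j l) + Ab i' l) * |d l|) + ε * ∑ j, R i' j * ζ j := by
        rw [a1, hswap, add_right_comm]
        simp only [hg, ← Finset.sum_add_distrib]
        congr 1
        exact Finset.sum_congr rfl fun l _ => by ring
      rw [s1, add_mul, Finset.sum_mul]
      refine add_le_add (Finset.sum_le_sum fun l _ => ?_) ?_
      · calc ((∑ j, R i' j * Zh j l) + Ab i' l) * |d l| * E i'
            = (((∑ j, R i' j * Zh j l) + Ab i' l) * E i') * |d l| := by ring
          _ ≤ Zh i' l * |d l| := mul_le_mul_of_nonneg_right (hfix i' l) (abs_nonneg _)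
      · calc ε * (∑ j, R i' j * ζ j) * E i' = ε * ((∑ j, R i' j * ζ j) * E i') := by ring
          _ ≤ ε * ζ i' := mul_le_mul_of_nonneg_left (hζ i') hε.le
    have hKZ := abs_le_of_componentwisePerturbation_uniform hh hyc hyd hy0 hR hg0 hZ0 hfield hE hZ ht i
    exact hKZ.1.trans hKZ.2
  have hζi := hζ0 i
  refine le_of_forall_pos_le_add fun ε hε => ?_
  have := hbound (ε / ζ i) (div_pos hε hζi)
  rwa [div_mul_cancel₀ _ hζi.ne'] at this

/-- **FORCED DEVIATION, linear in two forcing amplitudes** (the shape of the tail sensitivity (O2): two runs from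
the SAME start whose wake / top tails differ by at most `B` / `E`; and of the inclusion deviation (O1): a
realisation against the centre run from the same start, forcing = inclusion half-widths). If `y(0) = 0` and on
`[0, h]` `y' = A(t) y + δ(t)` with real matrices `A(t)` (`A_ii ≤ dg_i`, `|A_ij| ≤ R_ij` off the diagonal — any, per
`t`) and forcings `|δ_i(t)| ≤ cb_i B + ce_i E` (`B, E ≥ 0`), weights `E_i ≥ ∫₀ʰ e^{dg_i r} dr`, the two vector fixed
points `(Σ_j R_ij Ẑb_j + cb_i) Ew_i ≤ Ẑb_i`, `(Σ_j R_ij Ẑe_j + ce_i) Ew_i ≤ Ẑe_i` and a contraction direction `ζ > 0`,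
then `|y(t)_i| ≤ Ẑb_i B + Ẑe_i E` on `[0, h]`. [cite: KapelaZgliczynski2009, §4 Lemma 8 / Thm. 9; cell vocabulary, harvest/h2-tao-ladder rung1/KERNEL-CHEAP-REPLAY-SPEC.md §2 (d)/(f) (Δ_s, D_s) and §3 S5 (χ-vectors)] -/
theorem abs_forcedDeviation_le {y y' : ℝ → ι → ℝ} {h : ℝ} (hh : 0 ≤ h)
    (hy : ∀ t ∈ Icc 0 h, HasDerivWithinAt y (y' t) (Icc 0 h) t) (hy0 : y 0 = 0)
    {dg cb ce Zb Ze Ew ζ : ι → ℝ} {R : ι → ι → ℝ} {B E : ℝ} (hB : 0 ≤ B) (hE0 : 0 ≤ E)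
    (hR : ∀ i j, 0 ≤ R i j) (hcb : ∀ i, 0 ≤ cb i) (hce : ∀ i, 0 ≤ ce i) (hZb : ∀ i, 0 ≤ Zb i)
    (hZe : ∀ i, 0 ≤ Ze i)
    (hstruct : ∀ t ∈ Ico 0 h, ∃ (A : Matrix ι ι ℝ) (δ : ι → ℝ), y' t = A.mulVec (y t) + δ ∧
      (∀ i, A i i ≤ dg i) ∧ (∀ i j, i ≠ j → |A i j| ≤ R i j) ∧ (∀ i, |δ i| ≤ cb i * B + ce i * E))
    (hEw : ∀ i, gronwallBound 0 (dg i) 1 h ≤ Ew i)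
    (hfixb : ∀ i, ((∑ j, R i j * Zb j) + cb i) * Ew i ≤ Zb i)
    (hfixe : ∀ i, ((∑ j, R i j * Ze j) + ce i) * Ew i ≤ Ze i)
    (hζ0 : ∀ i, 0 < ζ i) (hζ : ∀ i, (∑ j, R i j * ζ j) * Ew i ≤ ζ i) :
    ∀ t ∈ Icc 0 h, ∀ i, |y t i| ≤ Zb i * B + Ze i * E := by
  classical
  intro t ht i
  have hyc : ContinuousOn y (Icc 0 h) := fun s hs => (hy s hs).continuousWithinAt
  have hyd : ∀ s ∈ Ico 0 h, HasDerivWithinAt y (y' s) (Ici s) s := by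
    intro s hs
    have hmem : Icc 0 h ∈ 𝓝[≥] s := mem_of_superset (Icc_mem_nhdsGE hs.2) (Icc_subset_Icc_left hs.1)
    exact (hy s (Ico_subset_Icc_self hs)).mono_of_mem_nhdsWithin hmem
  set g : ι → ℝ := fun i => cb i * B + ce i * E with hg
  have hg0 : ∀ i, 0 ≤ g i := fun i => add_nonneg (mul_nonneg (hcb i) hB) (mul_nonneg (hce i) hE0)
  have hfield : ∀ s ∈ Ico 0 h, ∀ i, ∃ a ≤ dg i, |y' s i - a * y s i| ≤ (∑ j, R i j * |y s j|) + g i := by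
    intro s hs i
    obtain ⟨A, δ, hA, hdiag, hoff, hδ⟩ := hstruct s hs
    refine ⟨A i i, hdiag i, ?_⟩
    have e : y' s i - A i i * y s i = (∑ j ∈ Finset.univ.erase i, A i j * y s j) + δ i := by
      rw [hA, Pi.add_apply, Finset.sum_erase_eq_sub (Finset.mem_univ i)]
      simp only [Matrix.mulVec, dotProduct]
      ring
    rw [e]
    refine (abs_add_le _ _).trans (add_le_add ?_ (hδ i))
    calc |∑ j ∈ Finset.univ.erase i, A i j * y s j| ≤ ∑ j ∈ Finset.univ.erase i, |A i j * y s j| :=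
          Finset.abs_sum_le_sum_abs _ _
      _ ≤ ∑ j ∈ Finset.univ.erase i, R i j * |y s j| := Finset.sum_le_sum fun j hj => by
          rw [abs_mul]
          exact mul_le_mul_of_nonneg_right (hoff i j (Finset.ne_of_mem_erase hj).symm) (abs_nonneg _)
      _ ≤ ∑ j, R i j * |y s j| :=
          Finset.sum_le_sum_of_subset_of_nonneg (Finset.erase_subset _ _)
            fun j _ _ => mul_nonneg (hR i j) (abs_nonneg _)
  have hbound : ∀ ε : ℝ, 0 < ε → |y t i| ≤ (Zb i * B + Ze i * E) + ε * ζ i := by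
    intro ε hε
    set Z : ι → ℝ := fun i => (Zb i * B + Ze i * E) + ε * ζ i with hZdef
    have hZ0 : ∀ i, 0 < Z i := fun i =>
      add_pos_of_nonneg_of_pos (add_nonneg (mul_nonneg (hZb i) hB) (mul_nonneg (hZe i) hE0)) (mul_pos hε (hζ0 i))
    have hZ : ∀ i', ((∑ j, R i' j * Z j) + g i') * Ew i' ≤ Z i' := by
      intro i'
      have s1 : (∑ j, R i' j * Z j) + g i' =
          ((∑ j, R i' j * Zb j) + cb i') * B + ((∑ j, R i' j * Ze j) + ce i') * E + ε * ∑ j, R i' j * ζ j := by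
        simp only [hZdef, hg, Finset.sum_mul, Finset.mul_sum, add_mul]
        have : ∀ j, R i' j * (Zb j * B + Ze j * E + ε * ζ j) =
            R i' j * Zb j * B + R i' j * Ze j * E + ε * (R i' j * ζ j) := fun j => by ring
        simp only [this, Finset.sum_add_distrib]
        ring
      rw [s1]
      have h1 : ((∑ j, R i' j * Zb j) + cb i') * B * Ew i' ≤ Zb i' * B := by
        rw [mul_right_comm]; exact mul_le_mul_of_nonneg_right (hfixb i') hB
      have h2 : ((∑ j, R i' j * Ze j) + ce i') * E * Ew i' ≤ Ze i' * E := by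
        rw [mul_right_comm]; exact mul_le_mul_of_nonneg_right (hfixe i') hE0
      have h3 : ε * (∑ j, R i' j * ζ j) * Ew i' ≤ ε * ζ i' := by
        rw [mul_assoc]; exact mul_le_mul_of_nonneg_left (hζ i') hε.le
      simp only [hZdef]
      nlinarith [h1, h2, h3]
    have hKZ := abs_le_of_componentwisePerturbation_uniform hh hyc hyd hy0 hR hg0 hZ0 hfield hEw hZ ht i
    exact hKZ.1.trans hKZ.2
  have hζi := hζ0 i
  refine le_of_forall_pos_le_add fun ε hε => ?_
  have := hbound (ε / ζ i) (div_pos hε hζi)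
  rwa [div_mul_cancel₀ _ hζi.ne'] at this

end DSSOneShift

end Summit.NavierStokesRegularity.NavierStokesRegularity.Theorems
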